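import Literature.Geometry.Lorentzian.KerrDataAsymptoticFlatness
import Literature.Geometry.Lorentzian.KerrSchildDecayFine
import Literature.MeasureTheory.Hausdorff.SphereArea
import HarnessLib

/-!
# The ADM energy of the Kerr–Schild slice data is `M` (all spins)

Discharge of the named fact `Kerr.hasADMEnergy_data` (`KerrData.lean`): for every mass `M ≥ 0`, every
spin parameter `a` and every inner radius `r₀`, the ADM energy fluxes
`E(r) = (16π)⁻¹ ∮_{‖x‖ = r} Σᵢⱼ (∂ⱼ h_ij − ∂ᵢ h_jj) xⁱ/r dμHE[2]` (`AFEnd.admEnergyFlux`) of the Kerr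
initial data set `Kerr.data M a r₀ hM` on the end `Kerr.afEnd a r₀` converge to `M`
(`AFEnd.HasADMEnergy`; Arnowitt–Deser–Misner 1962; Bartnik, CPAM 39 (1986), (4.2)).

The proof is the classical Kerr–Schild computation. In the (tautological) Kerr–Schild Cartesian chart
of the end the metric components are `h_ij(z) = g_{(0,z)}((0,eᵢ),(0,eⱼ))` (`Kerr.hCoeff_afEnd_data_apply`),
and `g_a = g₀ + O₁(ρ⁻²)` on the slice (`Kerr.isBigOSmooth_bilin_sub_zero_ofTimeSpace`, the spin enters
only at second order), where the Schwarzschild part is the closed form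
`g₀((0,v),(0,w)) = hRep M z v w = ⟪v,w⟫ + (2M/ρ³)⟪z,v⟫⟪z,w⟫` (`Kerr.bilin_zero_ofTimeSpace`) with the
explicit first derivatives `Kerr.hRepDeriv` (`KerrDataSchwarzschildMetric.lean`). Hence

* `Kerr.sum_hRepDeriv_admIntegrand` — the Schwarzschild integrand is *exactly*
  `Σᵢⱼ (∂ⱼ h⁰_ij − ∂ᵢ h⁰_jj)(x) xᵢ = 4M/ρ` (so `4M/ρ²` after division by `ρ`);
* `Kerr.isBigOSmooth_spinCorrection` — the spin correction of the integrand (times `ρ`) is a symbol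
  of order `ρ⁻²` (derivatives of `g_a − g₀ ∈ O₁(ρ⁻²)` times a coordinate);
* `Kerr.partialH_afEnd_data_eq`, `Kerr.admIntegrand_afEnd_data_eq` — on far spheres the ADM integrand
  of the Kerr data is `4M/r² + (spin correction)/r`;
* `Kerr.abs_admEnergyFlux_afEnd_data_sub_le` — `|E(r) − M| ≤ C/(4r)` for large `r`
  (`μHE[2](S_r) = 4πr²`, `Literature/MeasureTheory/Hausdorff/SphereArea.lean`);
* `Kerr.hasADMEnergy_afEnd_data` and **`Kerr.hasADMEnergy_data_holds`** — the named fact, verbatim.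

Everything is proved; no definitions, no named facts. The companion fact `Kerr.hasADMMomentum_data_zero`
(vanishing ADM momentum) is NOT treated here.

## References

* R. Arnowitt, S. Deser, C. W. Misner, *The dynamics of general relativity* (1962) (the flux).
* R. Bartnik, *The mass of an asymptotically flat manifold*, CPAM 39 (1986), (4.2).
* G. B. Cook, *Initial data for numerical relativity*, Living Rev. Relativ. 3 (2000) 5, §3.2.2, (55)
  (`h_ij = δ_ij + 2H ℓᵢℓⱼ`).
* A. García-Parrado, J. A. Valiente Kroon, *Kerr initial data*, J. Geom. Phys. 58 (2008), §5
  (the spin corrections are of relative order `ρ⁻²`; `E_ADM = M`).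
* M. Visser, *The Kerr spacetime: a brief introduction*, arXiv:0706.0622, §4–§5.
-/

noncomputable section

open Set Filter Asymptotics Bornology Metric MeasureTheory Topology
open scoped Real ContDiff RealInnerProductSpace Manifold ENNReal

namespace Literature.Geometry.Lorentzian

open Literature.MeasureTheory.Hausdorff

namespace Kerr

/-! ### The Schwarzschild part of the integrand is exactly `4M/ρ²` -/

section Schwarzschild

variable (M : ℝ)

/-- The components `y ↦ h⁰(y)(v, w)` of the Schwarzschild representative `hRep M` are differentiable
away from the origin, with derivative `u ↦ hRepDeriv M y u v w` (evaluation of `Kerr.hasFDerivAt_hRep`).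
Cook 2000, §3.2.2, (55). [cite: Cook2000, §3.2.2 (55)] -/
theorem hasFDerivAt_hRep_apply {y : E3} (hy : y ≠ 0) (v w : E3) :
    HasFDerivAt (fun y : E3 ↦ hRep M y v w) (((hRepDeriv M y).flip v).flip w) y := by
  have h := ((hasFDerivAt_hRep M hy).clm_apply (hasFDerivAt_const v y)).clm_apply
    (hasFDerivAt_const w y)
  refine h.congr_fderiv ?_
  ext u
  simp

/-- `∂ᵤ (h⁰(·)(v, w))(y) = hRepDeriv M y u v w` away from the origin. Cook 2000, §3.2.2, (55).
[cite: Cook2000, §3.2.2 (55)] -/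
theorem fderiv_hRep_apply_apply {y : E3} (hy : y ≠ 0) (v w u : E3) :
    fderiv ℝ (fun y : E3 ↦ hRep M y v w) y u = hRepDeriv M y u v w := by
  rw [(hasFDerivAt_hRep_apply M hy v w).fderiv]
  rfl

/-- **The ADM integrand of the Schwarzschild Kerr–Schild slice metric is exact**: for
`h⁰_ij = δ_ij + 2M xᵢxⱼ/ρ³` one has `Σᵢⱼ (∂ⱼ h⁰_ij − ∂ᵢ h⁰_jj)(x) xᵢ = 4M/ρ` at every `x ≠ 0`
(`Σⱼ ∂ⱼ h⁰_ij = 2M xᵢ/ρ³`, `Σⱼ ∂ᵢ h⁰_jj = −2M xᵢ/ρ³`), whence the flux integrand `4M/ρ²`.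
Arnowitt–Deser–Misner 1962; Visser arXiv:0706.0622, §5; Bartnik 1986, (4.2).
[cite: ArnowittDeserMisner1962] -/
theorem sum_hRepDeriv_admIntegrand {x : E3} (hx : x ≠ 0) :
    ∑ i : Fin 3, ∑ j : Fin 3,
      (hRepDeriv M x (EuclideanSpace.single j 1) (EuclideanSpace.single i 1)
          (EuclideanSpace.single j 1) -
        hRepDeriv M x (EuclideanSpace.single i 1) (EuclideanSpace.single j 1)
          (EuclideanSpace.single j 1)) * x i = 4 * M / ‖x‖ := by
  have hr : ‖x‖ ≠ 0 := norm_ne_zero_iff.2 hx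
  have hsq : ‖x‖ ^ 2 = x 0 ^ 2 + x 1 ^ 2 + x 2 ^ 2 := by
    rw [EuclideanSpace.real_norm_sq_eq, Fin.sum_univ_three]
  simp only [hRepDeriv_apply, EuclideanSpace.inner_single_right, PiLp.single_apply,
    Fin.sum_univ_three, Fin.isValue, one_mul]
  simp
  field_simp
  linear_combination (-4 * M * ‖x‖ ^ 2) * hsq

end Schwarzschild

/-! ### The spin correction is of lower order -/

section Spin

variable (M a : ℝ)

/-- **The spin correction of the metric components is a symbol of order `ρ⁻²` with one derivative**:
`z ↦ g_a((0,eᵢ),(0,eⱼ))(0,z) − h⁰_ij(z) ∈ O₁(ρ⁻²)`, from `g_a − g₀ ∈ O₁(ρ⁻²)`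
(`Kerr.isBigOSmooth_bilin_sub_zero_ofTimeSpace`) and `g₀((0,v),(0,w)) = hRep M z v w` off the origin
(`Kerr.bilin_zero_ofTimeSpace`). García-Parrado–Valiente Kroon 2008, §5
(`h_ij = δ_ij + 2M xᵢxⱼ/r³ + O(r⁻²)`). [cite: Kroon2008, §5] -/
theorem isBigOSmooth_bilin_ofTimeSpace_sub_hRep (i j : Fin 3) :
    IsBigOSmooth 1 (-2) fun z : E3 ↦
      bilin M a (E4.ofTimeSpace 0 z) (E4.ofTimeSpace 0 (EuclideanSpace.single i 1))
          (E4.ofTimeSpace 0 (EuclideanSpace.single j 1)) -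
        hRep M z (EuclideanSpace.single i 1) (EuclideanSpace.single j 1) := by
  have h := ((isBigOSmooth_bilin_sub_zero_ofTimeSpace M a 1).clm_apply_const
    (E4.ofTimeSpace 0 (EuclideanSpace.single i (1 : ℝ)))).clm_apply_const
    (E4.ofTimeSpace 0 (EuclideanSpace.single j (1 : ℝ)))
  refine h.congr_far (R₁ := 0) fun z hz ↦ ?_
  rw [_root_.sub_apply, _root_.sub_apply, bilin_zero_ofTimeSpace M (norm_pos_iff.1 hz)]

/-- **The spin correction of the ADM integrand (times `ρ`) is a symbol of order `ρ⁻²`**: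
`z ↦ Σᵢⱼ (∂ⱼ d_ij − ∂ᵢ d_jj)(z) zᵢ ∈ O₀(ρ⁻²)` for `d_ij = g_a((0,eᵢ),(0,eⱼ)) − h⁰_ij ∈ O₁(ρ⁻²)`
(derivatives of symbols lose one order, a coordinate gains one). García-Parrado–Valiente Kroon 2008,
§5 (the `a`-dependent corrections to the ADM integrand are `O(r⁻³)`). [cite: Kroon2008, §5] -/
theorem isBigOSmooth_spinCorrection :
    IsBigOSmooth 0 (-2) fun z : E3 ↦ ∑ i : Fin 3, ∑ j : Fin 3,
      (fderiv ℝ (fun z : E3 ↦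
            bilin M a (E4.ofTimeSpace 0 z) (E4.ofTimeSpace 0 (EuclideanSpace.single i 1))
                (E4.ofTimeSpace 0 (EuclideanSpace.single j 1)) -
              hRep M z (EuclideanSpace.single i 1) (EuclideanSpace.single j 1)) z
            (EuclideanSpace.single j 1) -
          fderiv ℝ (fun z : E3 ↦
            bilin M a (E4.ofTimeSpace 0 z) (E4.ofTimeSpace 0 (EuclideanSpace.single j 1))
                (E4.ofTimeSpace 0 (EuclideanSpace.single j 1)) -
              hRep M z (EuclideanSpace.single j 1) (EuclideanSpace.single j 1)) z
            (EuclideanSpace.single i 1)) * z i := by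
  refine IsBigOSmooth.finset_sum _ fun i _ ↦ IsBigOSmooth.finset_sum _ fun j _ ↦ ?_
  have h₁ := (isBigOSmooth_bilin_ofTimeSpace_sub_hRep M a i j).fderiv_apply_const
    (EuclideanSpace.single j (1 : ℝ))
  have h₂ := (isBigOSmooth_bilin_ofTimeSpace_sub_hRep M a j j).fderiv_apply_const
    (EuclideanSpace.single i (1 : ℝ))
  have h := (h₁.sub h₂).mul (isBigOSmooth_coord i 0)
  rw [show (-2 : ℝ) - 1 + 1 = -2 by norm_num] at h
  exact h

end Spin

/-! ### The ADM integrand of the Kerr data on far spheres -/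

section End

variable [Facts] [SliceFacts]

/-- **The coordinate derivatives of the chart components of the Kerr data**: for `‖x‖ > R`
(`R = Kerr.afRadius a r₀`), `∂ₗ h_ij(x) = hRepDeriv M x eₗ eᵢ eⱼ + ∂ₗ d_ij(x)` with the spin correction
`d_ij = g_a((0,eᵢ),(0,eⱼ)) − h⁰_ij` — near `x` the components are `h_ij = g_{(0,·)}((0,eᵢ),(0,eⱼ))`
(`Kerr.hCoeff_afEnd_data_apply`) `= h⁰_ij + d_ij`, both differentiable there (`g` is smooth on
`{r > 0}`, `h⁰` off the origin). Cook 2000, §3.2.2; García-Parrado–Valiente Kroon 2008, §5.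
[cite: Kroon2008, §5] -/
theorem partialH_afEnd_data_eq {M : ℝ} (hM : 0 ≤ M) (a r₀ : ℝ) {x : E3}
    (hx : afRadius a r₀ < ‖x‖) (l i j : Fin 3) :
    AFEnd.partialH (afEnd a r₀) (data M a r₀ hM) l i j x =
      hRepDeriv M x (EuclideanSpace.single l 1) (EuclideanSpace.single i 1)
          (EuclideanSpace.single j 1) +
        fderiv ℝ (fun z : E3 ↦
          bilin M a (E4.ofTimeSpace 0 z) (E4.ofTimeSpace 0 (EuclideanSpace.single i 1))
              (E4.ofTimeSpace 0 (EuclideanSpace.single j 1)) -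
            hRep M z (EuclideanSpace.single i 1) (EuclideanSpace.single j 1)) x
          (EuclideanSpace.single l 1) := by
  have hx0 : x ≠ 0 := norm_pos_iff.1 ((afRadius_pos a r₀).trans hx)
  have hr : 0 < radius a (E4.ofTimeSpace 0 x) :=
    radius_pos_of_mem_region (mem_slice_iff_ofTimeSpace_mem_region.1 (mem_slice_of_lt_norm hx))
  -- the components near `x`
  have hev : (fun y : E3 ↦ AFEnd.hCoeff (afEnd a r₀) (data M a r₀ hM) y (EuclideanSpace.single i 1)
      (EuclideanSpace.single j 1)) =ᶠ[𝓝 x] fun y ↦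
        hRep M y (EuclideanSpace.single i 1) (EuclideanSpace.single j 1) +
          (bilin M a (E4.ofTimeSpace 0 y) (E4.ofTimeSpace 0 (EuclideanSpace.single i 1))
              (E4.ofTimeSpace 0 (EuclideanSpace.single j 1)) -
            hRep M y (EuclideanSpace.single i 1) (EuclideanSpace.single j 1)) := by
    filter_upwards [(isOpen_lt continuous_const continuous_norm).mem_nhds hx] with y hy
    rw [hCoeff_afEnd_data_apply hM a r₀ hy, add_sub_cancel]
  -- differentiability of the two summands at `x`
  have h₁ : DifferentiableAt ℝ (fun y : E3 ↦ hRep M y (EuclideanSpace.single i 1)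
      (EuclideanSpace.single j 1)) x := (hasFDerivAt_hRep_apply M hx0 _ _).differentiableAt
  have hO : ContDiff ℝ 1 (E4.ofTimeSpace 0) :=
    contMDiff_iff_contDiff.mp (E4.contMDiff_ofTimeSpace 0 1)
  have hG : DifferentiableAt ℝ (fun z : E3 ↦ bilin M a (E4.ofTimeSpace 0 z)) x :=
    ((contDiffAt_bilin M a hr (n := 1)).comp x hO.contDiffAt).differentiableAt one_ne_zero
  have h₂ : DifferentiableAt ℝ (fun z : E3 ↦
      bilin M a (E4.ofTimeSpace 0 z) (E4.ofTimeSpace 0 (EuclideanSpace.single i 1))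
          (E4.ofTimeSpace 0 (EuclideanSpace.single j 1)) -
        hRep M z (EuclideanSpace.single i 1) (EuclideanSpace.single j 1)) x :=
    ((hG.clm_apply (differentiableAt_const _)).clm_apply (differentiableAt_const _)).sub h₁
  unfold AFEnd.partialH
  rw [hev.fderiv_eq, fderiv_fun_add h₁ h₂, _root_.add_apply, fderiv_hRep_apply_apply M hx0]

/-- **The ADM integrand of the Kerr data on far spheres**: for `‖x‖ = r > R`,
`Σᵢⱼ (∂ⱼ h_ij − ∂ᵢ h_jj)(x) xᵢ/r = 4M/r² + (Σᵢⱼ (∂ⱼ d_ij − ∂ᵢ d_jj)(x) xᵢ)/r` (Schwarzschild part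
exact, `Kerr.sum_hRepDeriv_admIntegrand`, plus the spin correction). Visser arXiv:0706.0622, §5;
García-Parrado–Valiente Kroon 2008, §5. [cite: Kroon2008, §5] -/
theorem admIntegrand_afEnd_data_eq {M : ℝ} (hM : 0 ≤ M) (a r₀ : ℝ) {x : E3}
    (hx : afRadius a r₀ < ‖x‖) {r : ℝ} (hxr : ‖x‖ = r) :
    ∑ i : Fin 3, ∑ j : Fin 3,
      (AFEnd.partialH (afEnd a r₀) (data M a r₀ hM) j i j x -
        AFEnd.partialH (afEnd a r₀) (data M a r₀ hM) i j j x) * x i / r =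
      4 * M / r ^ 2 + (∑ i : Fin 3, ∑ j : Fin 3,
        (fderiv ℝ (fun z : E3 ↦
            bilin M a (E4.ofTimeSpace 0 z) (E4.ofTimeSpace 0 (EuclideanSpace.single i 1))
                (E4.ofTimeSpace 0 (EuclideanSpace.single j 1)) -
              hRep M z (EuclideanSpace.single i 1) (EuclideanSpace.single j 1)) x
            (EuclideanSpace.single j 1) -
          fderiv ℝ (fun z : E3 ↦
            bilin M a (E4.ofTimeSpace 0 z) (E4.ofTimeSpace 0 (EuclideanSpace.single j 1))
                (E4.ofTimeSpace 0 (EuclideanSpace.single j 1)) -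
              hRep M z (EuclideanSpace.single j 1) (EuclideanSpace.single j 1)) x
            (EuclideanSpace.single i 1)) * x i) / r := by
  have hx0 : x ≠ 0 := norm_pos_iff.1 ((afRadius_pos a r₀).trans hx)
  have hr0 : r ≠ 0 := by rw [← hxr]; exact norm_ne_zero_iff.2 hx0
  simp only [partialH_afEnd_data_eq hM a r₀ hx]
  have key : ∀ (A B C D t : ℝ), (A + B - (C + D)) * t / r = (A - C) * t / r + (B - D) * t / r := by
    intro A B C D t
    ring
  simp only [key, Finset.sum_add_distrib]
  rw [← hxr]
  congr 1
  · simp only [← Finset.sum_div]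
    rw [sum_hRepDeriv_admIntegrand M hx0]
    ring
  · simp only [← Finset.sum_div]

end End

/-! ### The flux estimate and the limit -/

section Flux

variable [Facts] [SliceFacts]

/-- **The ADM fluxes of the Kerr data are `M + O(1/r)`**: there are `C ≥ 0` and `r₁` with
`|E(r) − M| ≤ C/(4r)` for `r ≥ r₁` — on `S_r` the integrand is `4M/r² + ε(x)/r` with
`|ε(x)| ≤ C/r²` (`Kerr.isBigOSmooth_spinCorrection`), and `μHE[2](S_r) = 4πr²`, so
`E(r) = (16π)⁻¹ (16πM + ∮ ε/r)` with `|∮ ε/r| ≤ 4πC/r`. Arnowitt–Deser–Misner 1962; Bartnik 1986,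
(4.2); García-Parrado–Valiente Kroon 2008, §5. [cite: ArnowittDeserMisner1962] -/
theorem abs_admEnergyFlux_afEnd_data_sub_le {M : ℝ} (hM : 0 ≤ M) (a r₀ : ℝ) :
    ∃ C : ℝ, 0 ≤ C ∧ ∃ r₁ : ℝ, ∀ r : ℝ, r₁ ≤ r →
      |AFEnd.admEnergyFlux (afEnd a r₀) (data M a r₀ hM) r - M| ≤ C / 4 / r := by
  -- the spin correction and its bounds
  set ε : E3 → ℝ := fun z ↦ ∑ i : Fin 3, ∑ j : Fin 3,
      (fderiv ℝ (fun z : E3 ↦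
            bilin M a (E4.ofTimeSpace 0 z) (E4.ofTimeSpace 0 (EuclideanSpace.single i 1))
                (E4.ofTimeSpace 0 (EuclideanSpace.single j 1)) -
              hRep M z (EuclideanSpace.single i 1) (EuclideanSpace.single j 1)) z
            (EuclideanSpace.single j 1) -
          fderiv ℝ (fun z : E3 ↦
            bilin M a (E4.ofTimeSpace 0 z) (E4.ofTimeSpace 0 (EuclideanSpace.single j 1))
                (E4.ofTimeSpace 0 (EuclideanSpace.single j 1)) -
              hRep M z (EuclideanSpace.single j 1) (EuclideanSpace.single j 1)) z
            (EuclideanSpace.single i 1)) * z i with hε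
  have hεO : IsBigOSmooth 0 (-2) ε := isBigOSmooth_spinCorrection M a
  obtain ⟨R₀, hR₀⟩ := hεO.1
  obtain ⟨C, hC0, hC⟩ := (hεO.isBigO (m := 0) le_rfl).exists_nonneg
  obtain ⟨R₂, hR₂⟩ := exists_radius_of_eventually_cobounded (isBigOWith_iff.1 hC)
  refine ⟨C, hC0, max (max (afRadius a r₀) R₂) R₀ + 1, fun r hr ↦ ?_⟩
  have hrR : afRadius a r₀ < r := by
    have := le_max_left (max (afRadius a r₀) R₂) R₀
    have := le_max_left (afRadius a r₀) R₂
    linarith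
  have hrR₂ : R₂ < r := by
    have := le_max_left (max (afRadius a r₀) R₂) R₀
    have := le_max_right (afRadius a r₀) R₂
    linarith
  have hrR₀ : R₀ < r := by
    have := le_max_right (max (afRadius a r₀) R₂) R₀
    linarith
  have hr0 : 0 < r := (afRadius_pos a r₀).trans hrR
  -- the pointwise bound on the sphere
  have hpt : ∀ x ∈ sphere (0 : E3) r, |ε x / r| ≤ C / r ^ 3 := by
    intro x hx
    rw [mem_sphere_zero_iff_norm] at hx
    have h := hR₂ x (by rw [hx]; exact hrR₂)
    rw [norm_norm, norm_iteratedFDeriv_zero, Real.norm_eq_abs,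
      Real.norm_of_nonneg (Real.rpow_nonneg (norm_nonneg _) _), hx, Nat.cast_zero, sub_zero,
      Real.rpow_neg hr0.le, Real.rpow_two] at h
    rw [abs_div, abs_of_pos hr0]
    calc |ε x| / r ≤ C * (r ^ 2)⁻¹ / r := div_le_div_of_nonneg_right h hr0.le
      _ = C / r ^ 3 := by field_simp
  -- measure of the sphere
  set μ : Measure E3 := μHE[2] with hμ
  set S : Set E3 := sphere 0 r with hS
  have hμS : μ S = ENNReal.ofReal (4 * Real.pi * r ^ 2) :=
    euclideanHausdorffMeasure_sphere_fin_three hr0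
  have hμS' : μ S < ⊤ := by rw [hμS]; exact ENNReal.ofReal_lt_top
  have hμSr : μ.real S = 4 * Real.pi * r ^ 2 := by
    rw [measureReal_def, hμS, ENNReal.toReal_ofReal (by positivity)]
  -- the integrand on the sphere
  have hcongr : ∫ x in S, ∑ i : Fin 3, ∑ j : Fin 3,
      (AFEnd.partialH (afEnd a r₀) (data M a r₀ hM) j i j x -
        AFEnd.partialH (afEnd a r₀) (data M a r₀ hM) i j j x) * x i / r ∂μ =
      ∫ x in S, (4 * M / r ^ 2 + ε x / r) ∂μ := by
    refine setIntegral_congr_fun isClosed_sphere.measurableSet fun x hx ↦ ?_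
    rw [hS, mem_sphere_zero_iff_norm] at hx
    exact admIntegrand_afEnd_data_eq hM a r₀ (by rw [hx]; exact hrR) hx
  -- integrability of the correction
  have hSO : S ⊆ {y : E3 | R₀ < ‖y‖} := fun x hx ↦ by
    rw [hS, mem_sphere_zero_iff_norm] at hx
    show R₀ < ‖x‖
    rw [hx]; exact hrR₀
  have hεc : ContinuousOn (fun x ↦ ε x / r) S := (hR₀.continuousOn.mono hSO).div_const _
  have hεm : AEStronglyMeasurable (fun x ↦ ε x / r) (μ.restrict S) :=
    hεc.aestronglyMeasurable isClosed_sphere.measurableSet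
  have hbd : ∀ x ∈ S, ‖ε x / r‖ ≤ C / r ^ 3 := fun x hx ↦ by
    rw [Real.norm_eq_abs]; exact hpt x hx
  have hεint : IntegrableOn (fun x ↦ ε x / r) S μ := by
    refine IntegrableOn.of_bound hμS' hεm (C / r ^ 3) ?_
    rw [ae_restrict_iff' isClosed_sphere.measurableSet]
    exact Eventually.of_forall hbd
  have hcint : IntegrableOn (fun _ : E3 ↦ 4 * M / r ^ 2) S μ := integrableOn_const hμS'.ne
  -- split the integral
  have hsplit : ∫ x in S, (4 * M / r ^ 2 + ε x / r) ∂μ =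
      16 * Real.pi * M + ∫ x in S, ε x / r ∂μ := by
    rw [integral_add hcint hεint, setIntegral_const, hμSr, smul_eq_mul]
    congr 1
    field_simp
    ring
  have herr : ‖∫ x in S, ε x / r ∂μ‖ ≤ C / r ^ 3 * (4 * Real.pi * r ^ 2) := by
    rw [← hμSr]
    exact norm_setIntegral_le_of_norm_le_const hμS' hbd
  -- conclusion
  unfold AFEnd.admEnergyFlux
  rw [hcongr, hsplit]
  set I : ℝ := ∫ x in S, ε x / r ∂μ with hI
  have hI' : (16 * Real.pi)⁻¹ * (16 * Real.pi * M + I) - M = (16 * Real.pi)⁻¹ * I := by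
    field_simp
    ring
  rw [hI', abs_mul, abs_of_pos (by positivity)]
  rw [Real.norm_eq_abs] at herr
  calc (16 * Real.pi)⁻¹ * |I|
      ≤ (16 * Real.pi)⁻¹ * (C / r ^ 3 * (4 * Real.pi * r ^ 2)) :=
        mul_le_mul_of_nonneg_left herr (by positivity)
    _ = C / 4 / r := by
        field_simp
        ring

/-- **The Kerr–Schild slice data have ADM energy `M`** on the end `Kerr.afEnd a r₀`, for every
`M ≥ 0`, every spin `a` and every `r₀`: the fluxes satisfy `|E(r) − M| ≤ C/(4r) → 0`
(`Kerr.abs_admEnergyFlux_afEnd_data_sub_le`). Arnowitt–Deser–Misner 1962; Bartnik 1986, (4.2);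
García-Parrado–Valiente Kroon 2008, §5; Visser arXiv:0706.0622, §5. [cite: ArnowittDeserMisner1962] -/
theorem hasADMEnergy_afEnd_data {M : ℝ} (hM : 0 ≤ M) (a r₀ : ℝ) :
    (afEnd a r₀).HasADMEnergy (data M a r₀ hM) M := by
  obtain ⟨C, -, r₁, hflux⟩ := abs_admEnergyFlux_afEnd_data_sub_le hM a r₀
  rw [AFEnd.HasADMEnergy]
  refine tendsto_sub_nhds_zero_iff.1 (squeeze_zero_norm' ?_
    (tendsto_const_nhds.div_atTop tendsto_id : Tendsto (fun r : ℝ ↦ C / 4 / r) atTop (𝓝 0)))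
  filter_upwards [eventually_ge_atTop r₁] with r hr
  rw [Real.norm_eq_abs]
  exact hflux r hr

/-- **Discharge of the named fact `Kerr.hasADMEnergy_data`** (`KerrData.lean`), verbatim and for all
`M, a, r₀`: under its leading binder `0 ≤ M`, the ADM energy fluxes of the Kerr data on
`Kerr.afEnd a r₀` converge to `M`. Arnowitt–Deser–Misner 1962; Bartnik 1986, (4.2); Visser
arXiv:0706.0622, §5. [cite: ArnowittDeserMisner1962] -/
theorem hasADMEnergy_data_holds : ∀ M a r₀ : ℝ, hasADMEnergy_data M a r₀ :=
  fun _ a r₀ hM ↦ hasADMEnergy_afEnd_data hM a r₀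

end Flux

end Kerr

end Literature.Geometry.Lorentzian

end
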